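import Summits.HodgeConjecture.HodgeConjecture.Theorems.Q8SymplecticPowersTranscendentalOrthogonal
import Literature.AlgebraicGeometry.HodgeTheory.HodgeNumbersBirationalInvariance
import Literature.AlgebraicGeometry.HodgeTheory.BirationalRoofOfSmoothProjective
import Literature.AlgebraicGeometry.HodgeTheory.BettiUniverseTracePairing
import Literature.AlgebraicGeometry.HodgeTheory.BettiUniverseTraceIntegral
import Literature.AlgebraicGeometry.HodgeTheory.SurjectivePullbackInjective
import Literature.AlgebraicGeometry.Motives.HodgeStructureQuotient
import HarnessLib

/-!
# Route `Q8SymplecticPowers`, crux K1Q — programme M2 (stub S2 `stub_autFreeReductionQ`), brick (T≅):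
# the TRANSCENDENTAL PART `T(X) = Hdg¹(H²X)^⊥` of a smooth projective surface is a birational invariant, as a rational Hodge
# structure with its trace form up to a non-zero scalar

Cell `hodge-nonav`, prover seat `hodge-nonav-prover-Bx` (g20). HELPER FILE for crux K1Q `VeryGeneralQuaternionCommutatorsInHg`
(stmt-HodgeConjecture-24190; `--supports … --as helper`; nothing here closes an item). Sorry-free; axioms standard.

For smooth projective complex surfaces `X`, `X'` and `T(X) = Hdg¹(H²X)^{⊥ψ}` (Huybrechts' transcendental part, the minimal sub-Hodge
structure containing `H^{2,0}`, `BettiUniverse.isTranscendentalPart_iff_eq_orthogonal`):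

* §0 `pull_injective_of_surjective` (`σ^*` is injective on `Hᵏ(−; ℚ)` for `σ` surjective, Voisin I Lemma 7.28 through
  `complexBetti_map_injective_of_surjective`), `exists_tr_cup_pull_pull_eq_mul` (**the light trace form transports up to a
  non-zero scalar along a surjective morphism of surfaces**: `tr_{X'}(σ^*x ∪ σ^*y) = c · tr_X(x ∪ y)`, `c ≠ 0` — both
  `tr_{X'} ∘ σ^*` and `tr_X` are non-zero functionals on the line `H⁴(X; ℚ)`).
* §1 **`transcendental_eq_map_pull_of_isBirational`**: for a birational MORPHISM `σ : X' → X`, `T(X') = σ^* T(X)` — `⊇` because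
  morphisms of polarised Hodge structures are block diagonal (`Polarization.map_orthogonal_hodgeClasses_le`), `⊆` by minimality of
  `T(X')` and `H^{2,0}(X') = σ^* H^{2,0}(X)` (brick (PG), `BettiUniverse.piece_hodge_zero_eq_map_of_isBirational`, Hartshorne II 8.19).
* §2 **`exists_transcendental_transport_of_birationalOver`**: for `X ~ X'` birational over `ℂ` (Mathlib `Scheme.BirationalOver`),
  an ISOMORPHISM OF HODGE STRUCTURES `Φ : T(X') ⥲ T(X)` (a pair of inverse morphisms) with
  `tr_X(Φ x ∪ Φ y) = c · tr_{X'}(x ∪ y)`, `c ≠ 0` — through the smooth projective roof `X ← X'' → X'` of brick (R)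
  (`exists_isSmoothProjective_roof_of_birationalOver`).

Honest scope: bookkeeping for S2; nothing here says K1Q, HC, HC_CM or HC_AV is proved.

References: R. Hartshorne, *Algebraic Geometry*, II Thm. 8.19, V Remark 5.6.1; D. Huybrechts, *Lectures on K3 Surfaces*, Ch. 3 Def. 2.5,
Lemma 3.1; C. Voisin, *Hodge Theory I*, §7.3.1 Lemma 7.26, §7.3.2 Lemma 7.28.
-/

set_option linter.dupNamespace false

noncomputable section

open scoped TensorProduct
open CategoryTheory AlgebraicGeometry
open Literature.AlgebraicGeometry Literature.AlgebraicGeometry.Motives Literature.AlgebraicGeometry.HodgeTheory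
open Literature.AlgebraicGeometry.HodgeTheory.BettiUniverse
open Literature.AlgebraicGeometry.Motives.HodgeStructure

namespace Summit.HodgeConjecture.HodgeConjecture.Theorems.Q8SymplecticPowersTranscendentalBirational

variable {n : ℕ} {X X' : SchemeOver ℂ}

/-! ### §0 Pull-back along a surjective morphism: injective, and a scaled isometry for the light trace form -/

/-- **`σ^*` is injective on `Hᵏ(−; ℚ)` for a surjective morphism `σ : X' → X`** of smooth projective varieties (Voisin I Lemma 7.28
on `Hᵏ(−; ℂ)`, `complexBetti_map_injective_of_surjective`, and `Hᵏ(ℚ) ↪ Hᵏ(ℂ)`). [cite: VoisinHodgeI2002, §7.3.2 Lemma 7.28] -/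
theorem pull_injective_of_surjective {m : ℕ} (hX' : IsSmoothProjective m X') (hX : IsSmoothProjective n X) (σ : X' ⟶ X)
    [Surjective σ.left] (k : ℕ) : Function.Injective (pull σ k) := by
  intro v w h
  apply ofRatClass_injective (Y := Motives.ComplexPoints X) k
  apply complexBetti_map_injective_of_surjective hX hX' σ k
  have e : ∀ u : bettiCohomology X k, complexBetti.map σ k (ofRatClass (Motives.ComplexPoints X) k u) =
      ofRatClass (Motives.ComplexPoints X') k (pull σ k u) :=
    fun u ↦ (Motives.ofRatClass_map k (Motives.AlgPoints.mapContinuous (L := ℂ) σ) u).symm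
  rw [e v, e w, h]

/-- **The light trace transports up to a non-zero scalar along a surjection of `n`-folds**: `tr_{X'}(σ^* z) = c · tr_X(z)`, `c ≠ 0`,
for `z ∈ H²ⁿ(X; ℚ)` — `tr_{X'} ∘ σ^*` and `tr_X` are non-zero functionals on the line `H²ⁿ(X; ℚ)` (`σ^*` maps it injectively, hence onto,
the line `H²ⁿ(X'; ℚ)`). [cite: HatcherAT2002, §3.3 Thm. 3.26] [cite: VoisinHodgeI2002, §7.3.2 Lemma 7.28] -/
theorem exists_tr_pull_eq_mul (hX' : IsSmoothProjective n X') (hX : IsSmoothProjective n X) (σ : X' ⟶ X) [Surjective σ.left] :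
    ∃ c : ℚ, c ≠ 0 ∧ ∀ z : bettiCohomology X (2 * n), tr hX' (2 * n) (pull σ (2 * n) z) = c * tr hX (2 * n) z := by
  haveI := finite hX (2 * n)
  haveI := finite hX' (2 * n)
  have hinj := pull_injective_of_surjective hX' hX σ (2 * n)
  -- `σ^*` is onto the line `H²ⁿ(X')`
  have hsurj : Function.Surjective (pull σ (2 * n)) := by
    have h := LinearMap.finrank_range_of_inj hinj
    rw [finrank_bettiCohomology_top hX] at h
    have htop : LinearMap.range (pull σ (2 * n)) = ⊤ :=
      Submodule.eq_top_of_finrank_eq (by rw [h, finrank_bettiCohomology_top hX'])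
    exact LinearMap.range_eq_top.1 htop
  have hφ : tr hX' (2 * n) ∘ₗ pull σ (2 * n) ≠ 0 := by
    intro h
    apply tr_top_ne_zero hX'
    refine LinearMap.ext fun x ↦ ?_
    obtain ⟨z, rfl⟩ := hsurj x
    have hz := LinearMap.congr_fun h z
    rw [LinearMap.comp_apply] at hz
    exact hz
  obtain ⟨c, hc, hcφ⟩ := exists_ne_zero_eq_smul_of_finrank_eq_one (finrank_bettiCohomology_top hX)
    (tr hX' (2 * n) ∘ₗ pull σ (2 * n)) (tr hX (2 * n)) hφ (tr_top_ne_zero hX)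
  refine ⟨c, hc, fun z ↦ ?_⟩
  have h := LinearMap.congr_fun hcφ z
  rw [LinearMap.comp_apply, LinearMap.smul_apply, smul_eq_mul] at h
  exact h

/-- **Scaled isometry for surfaces**: `tr_{X'}(σ^* x ∪ σ^* y) = c · tr_X(x ∪ y)` with one `c ≠ 0` for all `x, y ∈ H²(X; ℚ)`, along a surjective
morphism `σ : X' → X` of smooth projective surfaces (`σ^*` is multiplicative, `pull_cup`). [cite: HatcherAT2002, §3.2 Prop. 3.10 and §3.3 Thm. 3.26] -/
theorem exists_tr_cup_pull_pull_eq_mul (hX' : IsSmoothProjective 2 X') (hX : IsSmoothProjective 2 X) (σ : X' ⟶ X) [Surjective σ.left] :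
    ∃ c : ℚ, c ≠ 0 ∧ ∀ x y : bettiCohomology X 2,
      tr hX' (2 + 2) (cup X' 2 2 (pull σ 2 x) (pull σ 2 y)) = c * tr hX (2 + 2) (cup X 2 2 x y) := by
  obtain ⟨c, hc, h⟩ := exists_tr_pull_eq_mul hX' hX σ
  refine ⟨c, hc, fun x y ↦ ?_⟩
  rw [← pull_cup]
  exact h (cup X 2 2 x y)

/-! ### §1 `T(X') = σ^* T(X)` for a birational morphism of smooth projective surfaces -/

/-- **The transcendental part is carried onto the transcendental part by a birational morphism** `σ : X' → X` of smooth projective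
surfaces: `T(X') = σ^* T(X)` for `T = Hdg¹^{⊥ψ}` (any polarisations). `⊇`: a morphism of polarised Hodge structures maps `Hdg¹(X)^⊥` into
`Hdg¹(X')^⊥` (block diagonality). `⊆`: `σ^* T(X)` is a sub-Hodge structure of `H²(X')` whose complexification contains
`σ^* H^{2,0}(X) = H^{2,0}(X')` (birational invariance of `p_g`, brick (PG)), and `T(X')` is the least such (Huybrechts' definition).
[cite: Huybrechts2016K3, Ch. 3 Def. 2.5 and Lemma 3.1] [cite: Hartshorne1977, II Thm. 8.19] [cite: Voisin2025, Cor. 2.12] -/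
theorem transcendental_eq_map_pull_of_isBirational (hX' : IsSmoothProjective 2 X') (hX : IsSmoothProjective 2 X) (σ : X' ⟶ X)
    (hσ : Resolution.IsBirational σ.left) (ψ : Polarization (hodge exists_isReal_hodgeModel_holds hX 2))
    (ψ' : Polarization (hodge exists_isReal_hodgeModel_holds hX' 2))
    {T : SubHodgeStructure (hodge exists_isReal_hodgeModel_holds hX 2)}
    (hT : T.toSubmodule = ψ.form.orthogonal ((hodge exists_isReal_hodgeModel_holds hX 2).hodgeClasses 1))
    {T' : SubHodgeStructure (hodge exists_isReal_hodgeModel_holds hX' 2)}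
    (hT' : T'.toSubmodule = ψ'.form.orthogonal ((hodge exists_isReal_hodgeModel_holds hX' 2).hodgeClasses 1)) :
    T'.toSubmodule = T.toSubmodule.map (pull σ 2) := by
  haveI := finite hX 2
  haveI := finite hX' 2
  have h11 : (1 : ℤ) + 1 = ((2 : ℕ) : ℤ) := by norm_num
  set f := pullHodgeHom exists_isReal_hodgeModel_holds hodgePQ_independent_of_hodgeModel_holds hX' hX σ 2 with hf
  refine le_antisymm ?_ ?_
  · -- minimality of `T(X')`
    have hTP' : (hodge exists_isReal_hodgeModel_holds hX' 2).IsTranscendentalPart T' :=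
      (isTranscendentalPart_iff_eq_orthogonal exists_isReal_hodgeModel_holds hX' ψ' T').2 hT'
    have hTP : (hodge exists_isReal_hodgeModel_holds hX 2).IsTranscendentalPart T :=
      (isTranscendentalPart_iff_eq_orthogonal exists_isReal_hodgeModel_holds hX ψ T).2 hT
    obtain ⟨U, hU⟩ := (f.comp T.subtypeHom).exists_subHodgeStructure_range
    have hmapU : T.toSubmodule.map (pull σ 2) = U.toSubmodule := by
      rw [hU]
      change _ = LinearMap.range (f.toLinearMap ∘ₗ T.toSubmodule.subtype)
      rw [LinearMap.range_comp, Submodule.range_subtype, hf, pullHodgeHom_toLinearMap]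
    rw [hmapU]
    refine hTP'.le U ?_
    -- `H^{2,0}(X') = σ^* H^{2,0}(X) ⊆ (σ^* T)_ℂ`
    have h20 := piece_hodge_zero_eq_map_of_isBirational exists_isReal_hodgeModel_holds hX' hX σ hσ 2
    push_cast at h20
    rw [h20, ← hmapU]
    rintro _ ⟨z, hz, rfl⟩
    have hzT : z ∈ T.toSubmodule.baseChange ℂ := hTP.piece_le hz
    -- `(σ^* ⊗ ℂ)(T_ℂ) ⊆ (σ^* T)_ℂ`
    rw [Submodule.baseChange_eq_span] at hzT ⊢
    refine Submodule.span_induction (p := fun w _ ↦ (pull σ 2).baseChange ℂ w ∈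
      Submodule.span ℂ ((T.toSubmodule.map (pull σ 2)).map (TensorProduct.mk ℚ ℂ (bettiCohomology X' 2) 1) : Set _)) ?_ ?_ ?_ ?_ hzT
    · rintro _ ⟨t, ht, rfl⟩
      refine Submodule.subset_span ⟨pull σ 2 t, ⟨t, ht, rfl⟩, ?_⟩
      simp [LinearMap.baseChange_tmul]
    · simp
    · intro a b _ _ ha hb
      rw [map_add]
      exact Submodule.add_mem _ ha hb
    · intro c a _ ha
      rw [map_smul]
      exact Submodule.smul_mem _ c ha
  · -- block diagonality of morphisms of polarised Hodge structures
    have h := Polarization.map_orthogonal_hodgeClasses_le ψ ψ' h11 f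
    rw [hf, pullHodgeHom_toLinearMap] at h
    rw [hT, hT']
    exact h

/-! ### §2 The transport `Φ : T(X') ⥲ T(X)` along a birational equivalence -/

/-- **`T(X)` is a birational invariant as a rational Hodge structure with its trace form up to a non-zero scalar.** For smooth
projective surfaces `X ~ X'` birational over `ℂ` (Mathlib `Scheme.BirationalOver`) and their transcendental parts `T = Hdg¹(H²X)^{⊥ψ}`,
`T' = Hdg¹(H²X')^{⊥ψ'}`: there are inverse morphisms of Hodge structures `Φ : T' → T`, `Φ' : T → T'` and `c ≠ 0` with
`tr_X(Φ x ∪ Φ y) = c · tr_{X'}(x ∪ y)` — built through a smooth projective roof `X ← X'' → X'` (brick (R)): `σ^*` restricts to an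
isomorphism `T(X) ⥲ T(X'')` (§1, injective by §0), and `Φ = (p^*|_T)⁻¹ ∘ q^*|_{T'}`.
[cite: Hartshorne1977, V Remark 5.6.1 and II Thm. 8.19] [cite: Huybrechts2016K3, Ch. 3 Def. 2.5] [cite: VoisinHodgeI2002, §7.3.1 Lemma 7.23] -/
theorem exists_transcendental_transport_of_birationalOver (hX : IsSmoothProjective 2 X) (hX' : IsSmoothProjective 2 X')
    (hbir : Scheme.BirationalOver X.hom X'.hom) (ψ : Polarization (hodge exists_isReal_hodgeModel_holds hX 2))
    (ψ' : Polarization (hodge exists_isReal_hodgeModel_holds hX' 2))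
    {T : SubHodgeStructure (hodge exists_isReal_hodgeModel_holds hX 2)}
    (hT : T.toSubmodule = ψ.form.orthogonal ((hodge exists_isReal_hodgeModel_holds hX 2).hodgeClasses 1))
    {T' : SubHodgeStructure (hodge exists_isReal_hodgeModel_holds hX' 2)}
    (hT' : T'.toSubmodule = ψ'.form.orthogonal ((hodge exists_isReal_hodgeModel_holds hX' 2).hodgeClasses 1)) :
    ∃ (Φ : Hom T'.toHodgeStructure T.toHodgeStructure) (Φ' : Hom T.toHodgeStructure T'.toHodgeStructure) (c : ℚ), c ≠ 0 ∧
      (∀ x, Φ.toLinearMap (Φ'.toLinearMap x) = x) ∧ (∀ y, Φ'.toLinearMap (Φ.toLinearMap y) = y) ∧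
      ∀ x y : T'.toSubmodule, tr hX (2 + 2) (cup X 2 2 (Φ.toLinearMap x : bettiCohomology X 2) (Φ.toLinearMap y)) =
        c * tr hX' (2 + 2) (cup X' 2 2 (x : bettiCohomology X' 2) y) := by
  haveI := finite hX 2
  haveI := finite hX' 2
  have h11 : (1 : ℤ) + 1 = ((2 : ℕ) : ℤ) := by norm_num
  -- the roof
  obtain ⟨X'', p, q, hX'', hp, hq⟩ := exists_isSmoothProjective_roof_of_birationalOver hX hX' hbir
  haveI := finite hX'' 2
  haveI : IsProper p.left := isProper_left_of_isSmoothProjective hX'' hX p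
  haveI : IsProper q.left := isProper_left_of_isSmoothProjective hX'' hX' q
  haveI : Surjective p.left := surjective_of_isBirational_of_universallyClosed' p.left hp
  haveI : Surjective q.left := surjective_of_isBirational_of_universallyClosed' q.left hq
  obtain ⟨ψ''⟩ := hodge_isPolarizable exists_isReal_hodgeModel_holds hX'' 2
  obtain ⟨T'', hT''⟩ := ψ''.exists_subHodgeStructure_eq_orthogonal_hodgeClasses h11
  -- `p^*|_T : T ⥲ T''` and `q^*|_{T'} : T' ⥲ T''`
  have hpT := transcendental_eq_map_pull_of_isBirational hX'' hX p hp ψ ψ'' hT hT''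
  have hqT := transcendental_eq_map_pull_of_isBirational hX'' hX' q hq ψ' ψ'' hT' hT''
  set fp := pullHodgeHom exists_isReal_hodgeModel_holds hodgePQ_independent_of_hodgeModel_holds hX'' hX p 2 with hfp
  set fq := pullHodgeHom exists_isReal_hodgeModel_holds hodgePQ_independent_of_hodgeModel_holds hX'' hX' q 2 with hfq
  have hαmem : ∀ t : T.toSubmodule, (fp.comp T.subtypeHom).toLinearMap t ∈ T''.toSubmodule := fun t ↦ by
    rw [hpT]; exact ⟨t, t.2, rfl⟩
  have hβmem : ∀ t : T'.toSubmodule, (fq.comp T'.subtypeHom).toLinearMap t ∈ T''.toSubmodule := fun t ↦ by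
    rw [hqT]; exact ⟨t, t.2, rfl⟩
  set α : Hom T.toHodgeStructure T''.toHodgeStructure := (fp.comp T.subtypeHom).codRestrict T'' hαmem with hα
  set β : Hom T'.toHodgeStructure T''.toHodgeStructure := (fq.comp T'.subtypeHom).codRestrict T'' hβmem with hβ
  have hαv : ∀ t : T.toSubmodule, (α.toLinearMap t : bettiCohomology X'' 2) = pull p 2 t := fun t ↦ rfl
  have hβv : ∀ t : T'.toSubmodule, (β.toLinearMap t : bettiCohomology X'' 2) = pull q 2 t := fun t ↦ rfl
  have hαbij : Function.Bijective α.toLinearMap := by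
    refine ⟨fun s t hst ↦ Subtype.ext (pull_injective_of_surjective hX'' hX p 2 ?_), fun u ↦ ?_⟩
    · rw [← hαv, ← hαv, hst]
    · have hu : (u : bettiCohomology X'' 2) ∈ T.toSubmodule.map (pull p 2) := hpT ▸ u.2
      obtain ⟨t, ht, htu⟩ := hu
      exact ⟨⟨t, ht⟩, Subtype.ext (by rw [hαv]; exact htu)⟩
  have hβbij : Function.Bijective β.toLinearMap := by
    refine ⟨fun s t hst ↦ Subtype.ext (pull_injective_of_surjective hX'' hX' q 2 ?_), fun u ↦ ?_⟩
    · rw [← hβv, ← hβv, hst]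
    · have hu : (u : bettiCohomology X'' 2) ∈ T'.toSubmodule.map (pull q 2) := hqT ▸ u.2
      obtain ⟨t, ht, htu⟩ := hu
      exact ⟨⟨t, ht⟩, Subtype.ext (by rw [hβv]; exact htu)⟩
  -- the scalars of the two legs
  obtain ⟨cp, hcp, hcpQ⟩ := exists_tr_cup_pull_pull_eq_mul hX'' hX p
  obtain ⟨cq, hcq, hcqQ⟩ := exists_tr_cup_pull_pull_eq_mul hX'' hX' q
  refine ⟨(α.inverse hαbij).comp β, (β.inverse hβbij).comp α, cq / cp, div_ne_zero hcq hcp, fun x ↦ ?_, fun y ↦ ?_, fun x y ↦ ?_⟩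
  · rw [Hom.comp_toLinearMap, Hom.comp_toLinearMap, LinearMap.comp_apply, LinearMap.comp_apply, Hom.apply_inverse_apply,
      Hom.inverse_apply_apply]
  · rw [Hom.comp_toLinearMap, Hom.comp_toLinearMap, LinearMap.comp_apply, LinearMap.comp_apply, Hom.apply_inverse_apply,
      Hom.inverse_apply_apply]
  · -- `cp · tr_X(Φx ∪ Φy) = tr_{X''}(p^*Φx ∪ p^*Φy) = tr_{X''}(q^*x ∪ q^*y) = cq · tr_{X'}(x ∪ y)`
    set Φx := ((α.inverse hαbij).comp β).toLinearMap x with hΦx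
    set Φy := ((α.inverse hαbij).comp β).toLinearMap y with hΦy
    have hx : pull p 2 (Φx : bettiCohomology X 2) = pull q 2 (x : bettiCohomology X' 2) := by
      rw [← hαv, ← hβv, hΦx, Hom.comp_toLinearMap, LinearMap.comp_apply, Hom.apply_inverse_apply]
    have hy : pull p 2 (Φy : bettiCohomology X 2) = pull q 2 (y : bettiCohomology X' 2) := by
      rw [← hαv, ← hβv, hΦy, Hom.comp_toLinearMap, LinearMap.comp_apply, Hom.apply_inverse_apply]
    have h1 := hcpQ (Φx : bettiCohomology X 2) (Φy : bettiCohomology X 2)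
    rw [hx, hy, hcqQ] at h1
    rw [div_mul_eq_mul_div, eq_div_iff hcp]
    linear_combination -h1

end Summit.HodgeConjecture.HodgeConjecture.Theorems.Q8SymplecticPowersTranscendentalBirational

end
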